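import Summits.CriticalPhenomena.PercolationContinuityZ3.Theorems.Transplant.FKConnectivityAllQArborealClusterTools
import HarnessLib

/-!
# The arboreal gas — the CONTRACTION IDENTITY (law of `F ∖ g` given `g ∈ F` = the arboreal gas without `g` conditioned on the
# endpoints of `g` lying in different trees) and the AFFINE DECOMPOSITION of the weights in the parameter of one pair

Support file (`--supports stmt-CriticalPhenomena-4575`), FK sub-lane `prim-bschramm-fk-1` (gen 10) of the post-continuity programme;
builds on p205010 (kernel theorem, internal audit signed; external expert review pending).  Tools only: no new definitions of
statements, no named facts, no sorries; standard axioms.  Companion of `…ArborealMonotone.lean` (forest-MM ⟺ local stochastic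
monotonicity of the arboreal gas; forest-MM ⇒ adjacent-pair negative correlation).

For the arboreal gas `μ^F_w = agMeasure w` (product measure `P_w` conditioned on acyclicity, Grimmett (1.22)) and a genuine pair
`g = s(x,y)`, `x ≠ y`:
* `isForestCfg_insert_iff` — for `g ∉ ω`: `ω ∪ {g}` is a forest iff `ω` is a forest and `x ↮ y` in `ω`;
* `agWeight_setW_true_insert` — `agWeight_{w[g↦1]}(ω ∪ {g}) = agWeight_{w[g↦0]}(ω)·1{x ↮ y}(ω)`;
* `sum_agWeight_setW_true_eq_sum_insert` — **contraction identity**: for ANY integrand `G`,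
  `Σ_ω agWeight_{w[g↦1]}(ω)·G(ω) = Σ_ω agWeight_{w[g↦0]}(ω)·1{x ↮ y}(ω)·G(ω ∪ {g})` (substitute `ω ↦ ω ∆ {g}`), whence
  `Z_{w[g↦1]} = Σ_ω agWeight_{w[g↦0]}(ω)·1{x ↮ y}(ω)` and the normalised form
  `E^F_{w[g↦1]}[h] = E^F_{w[g↦0]}[1{x ↮ y}·h(· ∪ {g})] / E^F_{w[g↦0]}[1{x ↮ y}]` (`agE_setW_true_eq`) — the forest analogue of fk-1 g9's
  random-cluster contraction identity `real_update_one_eq` (there the toggle costs `q⁻¹` on `{x ↮ y}`; here it is FORBIDDEN on `{x ↔ y}`);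
* `sum_agWeight_update_eq` — **affine decomposition**: `Σ_ω agWeight_{w[g↦c]}(ω)·h(ω) = c·Σ_ω agWeight_{w[g↦1]}·h + (1−c)·Σ_ω agWeight_{w[g↦0]}·h`
  for every parameter `c ∈ [0,1]` of the pair `g` (any `g`, loops included), and the same for `Z`.
[cite: Grimmett2006, §1.5 eq. (1.22), Thm. (1.23) (pp. 13–14); Thm. (3.1)(a) (p. 37); Thm. (3.7) (p. 39)]
-/

noncomputable section

namespace Summit.CriticalPhenomena.PercolationContinuityZ3.Theorems

namespace FK

open MeasureTheory Set Literature.Probability.LatticeModels Literature.Probability.Percolation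
open scoped Classical symmDiff
open BHK2006 DecisionTree

variable {V : Type*} [Fintype V] (w : Sym2 V → unitInterval)

/-! ### Forests and one inserted pair -/

omit [Fintype V] in
/-- Inserting the pair `s(x,y)` adds the edge `xy` to the open graph. [folklore] -/
theorem openGraph_insert_eq_sup_edge (x y : V) (ω : BondConfig V) :
    openGraph (insert s(x, y) ω) = openGraph ω ⊔ SimpleGraph.edge x y := by
  change SimpleGraph.fromEdgeSet (insert s(x, y) ω) = _
  rw [Set.insert_eq, SimpleGraph.fromEdgeSet_union, sup_comm (SimpleGraph.fromEdgeSet {s(x, y)})]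
  rfl

omit [Fintype V] in
/-- **Inserting a genuine pair**: for `g = s(x,y) ∉ ω` with `x ≠ y`, `ω ∪ {g}` is a forest configuration iff `ω` is one and `x ↮ y`
in `ω` (Mathlib's `isAcyclic_sup_fromEdgeSet_iff`). [cite: Grimmett2006, §1.5 (p. 13)] -/
theorem isForestCfg_insert_iff {x y : V} (hxy : x ≠ y) {ω : BondConfig V} (hg : s(x, y) ∉ ω) :
    IsForestCfg (insert s(x, y) ω) ↔ IsForestCfg ω ∧ ¬ (openGraph ω).Reachable x y := by
  have hgraph := openGraph_insert_eq_sup_edge x y ω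
  have hnadj : ¬ (openGraph ω).Adj x y := fun h => hg ((openGraph_adj _ x y).1 h).1
  have hd : ¬ (s(x, y)).IsDiag := fun h => hxy (Sym2.mk_isDiag_iff.1 h)
  constructor
  · rintro ⟨hl, ha⟩
    rw [hgraph, SimpleGraph.isAcyclic_sup_fromEdgeSet_iff] at ha
    refine ⟨⟨fun f hf => hl f (Set.mem_insert_of_mem _ hf), ha.1⟩, fun hr => ?_⟩
    rcases ha.2 hr with h | h
    · exact hxy h
    · exact hnadj h
  · rintro ⟨⟨hl, ha⟩, hr⟩
    refine ⟨?_, ?_⟩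
    · rintro f (rfl | hf)
      · exact hd
      · exact hl f hf
    · rw [hgraph, SimpleGraph.isAcyclic_sup_fromEdgeSet_iff]
      exact ⟨ha, fun h => absurd h hr⟩

/-! ### Weights under a revealed pair -/

/-- Under `w[g ↦ 1]` a configuration missing `g` carries no weight. [cite: Grimmett2006, Thm. (3.7) (p. 39)] -/
theorem agWeight_setW_true_eq_zero {g : Sym2 V} {ω : BondConfig V} (hg : g ∉ ω) : agWeight (setW w g true) ω = 0 := by
  unfold agWeight
  split_ifs with hF
  · rw [weight_eq_factor_mul _ g, if_neg hg, coe_setW_self]; simp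
  · rfl

/-- Under `w[g ↦ 0]` a configuration containing `g` carries no weight. [cite: Grimmett2006, Thm. (3.7) (p. 39)] -/
theorem agWeight_setW_false_eq_zero {g : Sym2 V} {ω : BondConfig V} (hg : g ∈ ω) : agWeight (setW w g false) ω = 0 := by
  unfold agWeight
  split_ifs with hF
  · rw [weight_eq_factor_mul _ g, if_pos hg, coe_setW_self]; simp
  · rfl

/-- **Inserting the revealed pair**: for `g = s(x,y) ∉ ω`, `x ≠ y`,
`agWeight_{w[g↦1]}(ω ∪ {g}) = agWeight_{w[g↦0]}(ω)·1{x ↮ y}(ω)` — off `g` the factors agree, at `g` both factors are `1`, and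
`ω ∪ {g}` is a forest exactly when `ω` is a forest with `x ↮ y`. [cite: Grimmett2006, §1.5 eq. (1.22) (p. 13); Thm. (3.7) (p. 39)] -/
theorem agWeight_setW_true_insert {x y : V} (hxy : x ≠ y) {ω : BondConfig V} (hg : s(x, y) ∉ ω) :
    agWeight (setW w s(x, y) true) (insert s(x, y) ω) =
      agWeight (setW w s(x, y) false) ω * ind (openConn x y : Set (BondConfig V))ᶜ ω := by
  by_cases hr : (openGraph ω).Reachable x y
  · have hnot : ¬ IsForestCfg (insert s(x, y) ω) := fun h => ((isForestCfg_insert_iff hxy hg).1 h).2 hr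
    rw [agWeight_of_not_isForestCfg _ hnot,
      ind_of_not_mem (show ω ∉ (openConn x y : Set (BondConfig V))ᶜ from fun h => h hr), mul_zero]
  · rw [ind_of_mem (show ω ∈ (openConn x y : Set (BondConfig V))ᶜ from hr), mul_one]
    by_cases hF : IsForestCfg ω
    · have hF' : IsForestCfg (insert s(x, y) ω) := (isForestCfg_insert_iff hxy hg).2 ⟨hF, hr⟩
      rw [agWeight_of_isForestCfg _ hF', agWeight_of_isForestCfg _ hF]
      unfold weight
      refine Finset.prod_congr rfl fun e _ => ?_
      dsimp only
      by_cases he : e = s(x, y)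
      · rw [he, if_pos (Set.mem_insert _ _), if_neg hg, coe_setW_self, coe_setW_self]; simp
      · have hmem : e ∈ insert s(x, y) ω ↔ e ∈ ω := by simp only [Set.mem_insert_iff, he, false_or]
        rw [setW_ne w he true, setW_ne w he false]
        by_cases heω : e ∈ ω
        · rw [if_pos (hmem.2 heω), if_pos heω]
        · rw [if_neg (fun h => heω (hmem.1 h)), if_neg heω]
    · have hnot : ¬ IsForestCfg (insert s(x, y) ω) := fun h => hF ((isForestCfg_insert_iff hxy hg).1 h).1
      rw [agWeight_of_not_isForestCfg _ hnot, agWeight_of_not_isForestCfg _ hF]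

/-! ### The contraction identity -/

/-- **Contraction identity for the arboreal gas**: for `g = s(x,y)`, `x ≠ y`, and ANY integrand `G`,
`Σ_ω agWeight_{w[g↦1]}(ω)·G(ω) = Σ_ω agWeight_{w[g↦0]}(ω)·1{x ↮ y}(ω)·G(ω ∪ {g})` — substitute `ω ↦ ω ∆ {g}`: configurations without
`g` carry no `w[g↦1]`-weight, configurations with `g` no `w[g↦0]`-weight.  In words: given that `g` is in the forest, the rest of the
forest is the arboreal gas without `g` CONDITIONED on the endpoints of `g` lying in different trees.
[cite: Grimmett2006, §1.5 eq. (1.22) (p. 13); Thm. (3.1)(a) (p. 37); Thm. (3.7) (p. 39)] -/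
theorem sum_agWeight_setW_true_eq_sum_insert {x y : V} (hxy : x ≠ y) (G : BondConfig V → ℝ) :
    ∑ ω : BondConfig V, agWeight (setW w s(x, y) true) ω * G ω =
      ∑ ω : BondConfig V, agWeight (setW w s(x, y) false) ω *
        (ind (openConn x y : Set (BondConfig V))ᶜ ω * G (insert s(x, y) ω)) := by
  let σ : Equiv.Perm (BondConfig V) := Function.Involutive.toPerm (fun ω : BondConfig V => ω ∆ {s(x, y)})
    (symmDiff_left_involutive {s(x, y)})
  calc ∑ ω : BondConfig V, agWeight (setW w s(x, y) true) ω * G ω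
      = ∑ ω : BondConfig V, agWeight (setW w s(x, y) true) (σ ω) * G (σ ω) :=
        (Equiv.sum_comp σ (fun ω => agWeight (setW w s(x, y) true) ω * G ω)).symm
    _ = _ := by
        refine Finset.sum_congr rfl fun ω _ => ?_
        change agWeight (setW w s(x, y) true) (ω ∆ {s(x, y)}) * G (ω ∆ {s(x, y)}) = _
        by_cases heω : s(x, y) ∈ ω
        · have hnot : s(x, y) ∉ ω ∆ {s(x, y)} := by simp [Set.mem_symmDiff, heω]
          rw [agWeight_setW_true_eq_zero w hnot, agWeight_setW_false_eq_zero w heω]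
          ring
        · have hins : ω ∆ {s(x, y)} = insert s(x, y) ω := by
            ext f
            simp only [Set.mem_symmDiff, Set.mem_singleton_iff, Set.mem_insert_iff]
            constructor
            · rintro (⟨hf, -⟩ | ⟨rfl, -⟩)
              · exact Or.inr hf
              · exact Or.inl rfl
            · rintro (rfl | hf)
              · exact Or.inr ⟨rfl, heω⟩
              · exact Or.inl ⟨hf, fun h => heω (h ▸ hf)⟩
          rw [hins, agWeight_setW_true_insert w hxy heω]
          ring

/-- **Partition function after contraction**: `Z_{w[g↦1]} = Σ_ω agWeight_{w[g↦0]}(ω)·1{x ↮ y}(ω)`. [cite: Grimmett2006, §1.5 eq. (1.22) (p. 13)] -/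
theorem agPartition_setW_true_eq {x y : V} (hxy : x ≠ y) :
    agPartition (setW w s(x, y) true) =
      ∑ ω : BondConfig V, agWeight (setW w s(x, y) false) ω * ind (openConn x y : Set (BondConfig V))ᶜ ω := by
  have h := sum_agWeight_setW_true_eq_sum_insert w hxy (fun _ => (1 : ℝ))
  simp only [mul_one] at h
  unfold agPartition
  rw [← h]

/-- **Normalised contraction identity**: `E^F_{w[g↦1]}[h] = E^F_{w[g↦0]}[1{x ↮ y}·h(· ∪ {g})] / E^F_{w[g↦0]}[1{x ↮ y}]` (both sides are
`0` in the degenerate cases). [cite: Grimmett2006, Thm. (3.1)(a) (p. 37); Thm. (3.7) (p. 39)] -/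
theorem agE_setW_true_eq {x y : V} (hxy : x ≠ y) (h : BondConfig V → ℝ) :
    agE (setW w s(x, y) true) h =
      agE (setW w s(x, y) false) (fun ω => ind (openConn x y : Set (BondConfig V))ᶜ ω * h (insert s(x, y) ω)) /
        agE (setW w s(x, y) false) (ind (openConn x y : Set (BondConfig V))ᶜ) := by
  rw [agE_eq_sum_div, agE_eq_sum_div, agE_eq_sum_div, sum_agWeight_setW_true_eq_sum_insert w hxy h,
    agPartition_setW_true_eq w hxy]
  set N := ∑ ω : BondConfig V, agWeight (setW w s(x, y) false) ω *
    (ind (openConn x y : Set (BondConfig V))ᶜ ω * h (insert s(x, y) ω))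
  set D := ∑ ω : BondConfig V, agWeight (setW w s(x, y) false) ω * ind (openConn x y : Set (BondConfig V))ᶜ ω
  set Z := agPartition (setW w s(x, y) false)
  by_cases hZ : Z = 0
  · have h0 : ∀ ω, agWeight (setW w s(x, y) false) ω = 0 := fun ω =>
      (Finset.sum_eq_zero_iff_of_nonneg fun η _ => agWeight_nonneg (setW w s(x, y) false) η).1 hZ ω (Finset.mem_univ ω)
    have hN : N = 0 := Finset.sum_eq_zero fun ω _ => by rw [h0 ω, zero_mul]
    have hD : D = 0 := Finset.sum_eq_zero fun ω _ => by rw [h0 ω, zero_mul]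
    rw [hN, hD]; simp
  · rw [div_div_div_cancel_right₀ hZ]

/-! ### Affine decomposition in the parameter of one pair -/

omit [Fintype V] in
/-- Revealing twice is revealing once: `(w[g↦c])[g↦b] = w[g↦b]`. [folklore] -/
theorem setW_update (g : Sym2 V) (c : unitInterval) (b : Bool) : setW (Function.update w g c) g b = setW w g b := by
  unfold setW; rw [Function.update_idem]

/-- **Pointwise affine decomposition**: `agWeight_{w[g↦c]}(ω) = c·agWeight_{w[g↦1]}(ω) + (1 − c)·agWeight_{w[g↦0]}(ω)`.
[cite: Grimmett2006, Thm. (3.7) (p. 39)] -/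
theorem agWeight_update_eq (g : Sym2 V) (c : unitInterval) (ω : BondConfig V) :
    agWeight (Function.update w g c) ω =
      (c : ℝ) * agWeight (setW w g true) ω + (1 - (c : ℝ)) * agWeight (setW w g false) ω := by
  have h1 := agWeight_mul_ind_mem (Function.update w g c) g ω
  have h0 := agWeight_mul_ind_not_mem (Function.update w g c) g ω
  rw [setW_update, Function.update_self] at h1 h0
  have hsplit : agWeight (Function.update w g c) ω =
      agWeight (Function.update w g c) ω * ind {ω : BondConfig V | g ∈ ω} ω +
        agWeight (Function.update w g c) ω * ind {ω : BondConfig V | g ∉ ω} ω := by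
    by_cases hg : g ∈ ω
    · rw [ind_of_mem (show ω ∈ {ω : BondConfig V | g ∈ ω} from hg),
        ind_of_not_mem (show ω ∉ {ω : BondConfig V | g ∉ ω} from fun h => h hg)]; ring
    · rw [ind_of_not_mem (show ω ∉ {ω : BondConfig V | g ∈ ω} from hg),
        ind_of_mem (show ω ∈ {ω : BondConfig V | g ∉ ω} from hg)]; ring
  rw [hsplit, h1, h0]

/-- **Affine decomposition of weight sums** in the parameter `c` of the pair `g`:
`Σ_ω agWeight_{w[g↦c]}·h = c·Σ_ω agWeight_{w[g↦1]}·h + (1−c)·Σ_ω agWeight_{w[g↦0]}·h`. [cite: Grimmett2006, Thm. (3.7) (p. 39)] -/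
theorem sum_agWeight_update_eq (g : Sym2 V) (c : unitInterval) (h : BondConfig V → ℝ) :
    ∑ ω : BondConfig V, agWeight (Function.update w g c) ω * h ω =
      (c : ℝ) * ∑ ω : BondConfig V, agWeight (setW w g true) ω * h ω +
        (1 - (c : ℝ)) * ∑ ω : BondConfig V, agWeight (setW w g false) ω * h ω := by
  rw [Finset.mul_sum, Finset.mul_sum, ← Finset.sum_add_distrib]
  exact Finset.sum_congr rfl fun ω _ => by rw [agWeight_update_eq]; ring

/-- **Affine decomposition of the partition function**: `Z_{w[g↦c]} = c·Z_{w[g↦1]} + (1−c)·Z_{w[g↦0]}`. [cite: Grimmett2006, Thm. (3.7) (p. 39)] -/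
theorem agPartition_update_eq (g : Sym2 V) (c : unitInterval) :
    agPartition (Function.update w g c) = (c : ℝ) * agPartition (setW w g true) + (1 - (c : ℝ)) * agPartition (setW w g false) := by
  have h := sum_agWeight_update_eq w g c (fun _ => (1 : ℝ))
  simp only [mul_one] at h
  exact h

/-- **The present branch carries the factor `c`**: `Σ_ω agWeight_{w[g↦c]}(ω)·1{g ∈ ω}·h(ω) = c·Σ_ω agWeight_{w[g↦1]}(ω)·h(ω)`.
[cite: Grimmett2006, Thm. (3.7) (p. 39)] -/
theorem sum_agWeight_update_ind_mem_eq (g : Sym2 V) (c : unitInterval) (h : BondConfig V → ℝ) :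
    ∑ ω : BondConfig V, agWeight (Function.update w g c) ω * (ind {ω : BondConfig V | g ∈ ω} ω * h ω) =
      (c : ℝ) * ∑ ω : BondConfig V, agWeight (setW w g true) ω * h ω := by
  rw [Finset.mul_sum]
  refine Finset.sum_congr rfl fun ω _ => ?_
  have h1 := agWeight_mul_ind_mem (Function.update w g c) g ω
  rw [setW_update, Function.update_self] at h1
  rw [← mul_assoc, h1, mul_assoc]

/-- If `Z_{w[g↦0]} = 0` then `Z_{w[g↦1]} = 0` (a forest containing `g` stays a forest without it). [cite: Grimmett2006, §1.5 (p. 13)] -/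
theorem agPartition_setW_true_eq_zero_of_false {x y : V} (hxy : x ≠ y) (h0 : agPartition (setW w s(x, y) false) = 0) :
    agPartition (setW w s(x, y) true) = 0 := by
  have hz : ∀ ω, agWeight (setW w s(x, y) false) ω = 0 := fun ω =>
    (Finset.sum_eq_zero_iff_of_nonneg fun η _ => agWeight_nonneg (setW w s(x, y) false) η).1 h0 ω (Finset.mem_univ ω)
  rw [agPartition_setW_true_eq w hxy]
  exact Finset.sum_eq_zero fun ω _ => by rw [hz ω, zero_mul]

end FK

end Summit.CriticalPhenomena.PercolationContinuityZ3.Theorems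

end
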